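import Summits.CriticalPhenomena.PercolationContinuityZ3.Theorems.Transplant.FKConnectivityAllQAntipodalAndGenWeightSeries
import Summits.CriticalPhenomena.PercolationContinuityZ3.Theorems.Transplant.FKConnectivityAllQAntipodalAndGenParallel
import HarnessLib

/-!
# Connectivity correlation inequalities for `φ_{w,q}`, every `q > 0` — file 32aW: the GENERAL PARALLEL JUNCTION IDENTITY for the AND-drift with
# a LEVEL WEIGHT (towards Conjecture AND⁺ / C_∞⁺ for the AND type)

Support file (`--supports stmt-CriticalPhenomena-4575`), FK sub-lane `prim-bschramm-fk-2` (gen 21); builds on p205010 (kernel theorem,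
internal audit signed; external expert review pending).  No definitions, no named facts, no sorries; standard axioms.

File 32a (`…AndGenParallel.lean`, gen 19): across a parallel gluing at `{s, t}` of the host minus the root `st`,
`q^{2|V|} 𝔞(γ) = (1−c̄₂) q^{Y₂+Ḡ₂+1}(q^{Y₁+Ḡ₁} − q^{Ȳ₁+G₁}) + (1−c₁) q^{Ȳ₁+G₁+1}(q^{Y₂+Ḡ₂} − q^{Ȳ₂+G₂}) + c̄₂ q^{Y₂+Ḡ₂+2}(q^{Y₁+B̄₁} − q^{Ȳ₁+B₁})
 + c₁ q^{Ȳ₁+G₁+2}(q^{Y₂+B̄₂} − q^{Ȳ₂+B₂})` (`Y` = root inserted on the attached side, `G` = contracted side, `B` = contracted side with the root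
contracted too, `c` = `1{s↔t}` of the contracted side).  As for the series junction (file 32W) the exponents match termwise, so the identity holds
with `q^ℓ` replaced by any `w(ℓ)` (`FK.andGenW_summand_parallel`, `FK.andGenW_parallel_eq`), and the class of antitone weights being shift-invariant,
**`FK.andGenW_parallel_nonpos`**: the weighted general AND-drift property (for all antitone weights and monotone test functions) is closed under
parallel composition, the inputs being the property for the two sides and for the two sides with the root contracted.
[cite: Grimmett2006, §1.4 eq. (1.20) (p. 15); §3.8 Thm. (3.90) (pp. 61–62); §3.9 (pp. 63–64)] [cite: Wagner2006, Thm. 5.8(d), §5.3]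
-/

noncomputable section

namespace Summit.CriticalPhenomena.PercolationContinuityZ3.Theorems

namespace FK

open SimpleGraph Literature.Probability.LatticeModels Literature.Probability.Percolation
open scoped Classical

variable {V : Type*} [Fintype V]

section GenParallelW

variable {E₁ E₂ : Finset (Sym2 V)} {V₁ V₂ : Set V} {s t : V}

set_option linter.unusedSimpArgs false in
/-- **THE GENERAL PARALLEL JUNCTION IDENTITY, WEIGHTED (pointwise)** — file 32a's identity with `q^ℓ ↦ w(ℓ)` and the factor `q^{2|V|}` as the
shift `+ 2|V|` on the left. [cite: Grimmett2006, §3.8 (pp. 61–62)] -/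
theorem andGenW_summand_parallel (w : ℕ → ℝ) (h₁ : ∀ e ∈ (↑E₁ : Set (Sym2 V)), ∀ z ∈ e, z ∈ V₁)
    (h₂ : ∀ e ∈ (↑E₂ : Set (Sym2 V)), ∀ z ∈ e, z ∈ V₂) (hS : V₁ ∩ V₂ ⊆ {s, t}) (hst : s ≠ t)
    {N₁ A₁ C₁ N₂ A₂ C₂ γ₁ γ₂ : Finset (Sym2 V)} (hN₁ : N₁ ⊆ E₁) (hA₁ : A₁ ⊆ E₁) (hC₁ : C₁ ⊆ E₁)
    (hN₂ : N₂ ⊆ E₂) (hA₂ : A₂ ⊆ E₂) (hC₂ : C₂ ⊆ E₂) (hγ₁ : γ₁ ⊆ N₁) (hγ₂ : γ₂ ⊆ N₂) (x : ℝ) :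
    (w (clusterCount (↑(insert s(s, t) ((γ₁ ∪ A₁) ∪ (γ₂ ∪ A₂))) : BondConfig V) ∅ +
            clusterCount (↑((N₁ \ γ₁ ∪ C₁) ∪ (N₂ \ γ₂ ∪ C₂)) : BondConfig V) ∅ + 2 * Fintype.card V) -
        w (clusterCount (↑(insert s(s, t) ((N₁ \ γ₁ ∪ A₁) ∪ (N₂ \ γ₂ ∪ A₂))) : BondConfig V) ∅ +
            clusterCount (↑((γ₁ ∪ C₁) ∪ (γ₂ ∪ C₂)) : BondConfig V) ∅ + 2 * Fintype.card V)) * x =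
      (if (openGraph (↑(N₂ \ γ₂ ∪ C₂) : BondConfig V)).Reachable s t then 0 else 1) *
          ((w (clusterCount (↑(insert s(s, t) (γ₁ ∪ A₁)) : BondConfig V) ∅ + clusterCount (↑(N₁ \ γ₁ ∪ C₁) : BondConfig V) ∅ +
                (clusterCount (↑(insert s(s, t) (γ₂ ∪ A₂)) : BondConfig V) ∅ + clusterCount (↑(N₂ \ γ₂ ∪ C₂) : BondConfig V) ∅ + 1)) -
            w (clusterCount (↑(insert s(s, t) (N₁ \ γ₁ ∪ A₁)) : BondConfig V) ∅ + clusterCount (↑(γ₁ ∪ C₁) : BondConfig V) ∅ +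
                (clusterCount (↑(insert s(s, t) (γ₂ ∪ A₂)) : BondConfig V) ∅ + clusterCount (↑(N₂ \ γ₂ ∪ C₂) : BondConfig V) ∅ + 1))) * x) +
      (if (openGraph (↑(N₂ \ γ₂ ∪ C₂) : BondConfig V)).Reachable s t then 1 else 0) *
          ((w (clusterCount (↑(insert s(s, t) (γ₁ ∪ A₁)) : BondConfig V) ∅ + clusterCount (↑(insert s(s, t) (N₁ \ γ₁ ∪ C₁)) : BondConfig V) ∅ +
                (clusterCount (↑(insert s(s, t) (γ₂ ∪ A₂)) : BondConfig V) ∅ + clusterCount (↑(N₂ \ γ₂ ∪ C₂) : BondConfig V) ∅ + 2)) -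
            w (clusterCount (↑(insert s(s, t) (N₁ \ γ₁ ∪ A₁)) : BondConfig V) ∅ + clusterCount (↑(insert s(s, t) (γ₁ ∪ C₁)) : BondConfig V) ∅ +
                (clusterCount (↑(insert s(s, t) (γ₂ ∪ A₂)) : BondConfig V) ∅ + clusterCount (↑(N₂ \ γ₂ ∪ C₂) : BondConfig V) ∅ + 2))) * x) +
      (if (openGraph (↑(γ₁ ∪ C₁) : BondConfig V)).Reachable s t then 0 else 1) *
          ((w (clusterCount (↑(insert s(s, t) (γ₂ ∪ A₂)) : BondConfig V) ∅ + clusterCount (↑(N₂ \ γ₂ ∪ C₂) : BondConfig V) ∅ +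
                (clusterCount (↑(insert s(s, t) (N₁ \ γ₁ ∪ A₁)) : BondConfig V) ∅ + clusterCount (↑(γ₁ ∪ C₁) : BondConfig V) ∅ + 1)) -
            w (clusterCount (↑(insert s(s, t) (N₂ \ γ₂ ∪ A₂)) : BondConfig V) ∅ + clusterCount (↑(γ₂ ∪ C₂) : BondConfig V) ∅ +
                (clusterCount (↑(insert s(s, t) (N₁ \ γ₁ ∪ A₁)) : BondConfig V) ∅ + clusterCount (↑(γ₁ ∪ C₁) : BondConfig V) ∅ + 1))) * x) +
      (if (openGraph (↑(γ₁ ∪ C₁) : BondConfig V)).Reachable s t then 1 else 0) *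
          ((w (clusterCount (↑(insert s(s, t) (γ₂ ∪ A₂)) : BondConfig V) ∅ + clusterCount (↑(insert s(s, t) (N₂ \ γ₂ ∪ C₂)) : BondConfig V) ∅ +
                (clusterCount (↑(insert s(s, t) (N₁ \ γ₁ ∪ A₁)) : BondConfig V) ∅ + clusterCount (↑(γ₁ ∪ C₁) : BondConfig V) ∅ + 2)) -
            w (clusterCount (↑(insert s(s, t) (N₂ \ γ₂ ∪ A₂)) : BondConfig V) ∅ + clusterCount (↑(insert s(s, t) (γ₂ ∪ C₂)) : BondConfig V) ∅ +
                (clusterCount (↑(insert s(s, t) (N₁ \ γ₁ ∪ A₁)) : BondConfig V) ∅ + clusterCount (↑(γ₁ ∪ C₁) : BondConfig V) ∅ + 2))) * x) := by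
  have hω₁ : γ₁ ∪ A₁ ⊆ E₁ := Finset.union_subset (hγ₁.trans hN₁) hA₁
  have hωb₁ : N₁ \ γ₁ ∪ A₁ ⊆ E₁ := Finset.union_subset (Finset.sdiff_subset.trans hN₁) hA₁
  have hω₂ : γ₂ ∪ A₂ ⊆ E₂ := Finset.union_subset (hγ₂.trans hN₂) hA₂
  have hωb₂ : N₂ \ γ₂ ∪ A₂ ⊆ E₂ := Finset.union_subset (Finset.sdiff_subset.trans hN₂) hA₂
  have hφ₁ : γ₁ ∪ C₁ ⊆ E₁ := Finset.union_subset (hγ₁.trans hN₁) hC₁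
  have hφb₁ : N₁ \ γ₁ ∪ C₁ ⊆ E₁ := Finset.union_subset (Finset.sdiff_subset.trans hN₁) hC₁
  have hφ₂ : γ₂ ∪ C₂ ⊆ E₂ := Finset.union_subset (hγ₂.trans hN₂) hC₂
  have hφb₂ : N₂ \ γ₂ ∪ C₂ ⊆ E₂ := Finset.union_subset (Finset.sdiff_subset.trans hN₂) hC₂
  have eS := clusterCount_junction_genParallel h₁ h₂ hS hst hω₁ hω₂
  have eSb := clusterCount_junction_genParallel h₁ h₂ hS hst hωb₁ hωb₂
  have eC := clusterCount_union_parallel h₁ h₂ hS hst hφb₁ hφb₂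
  have eG := clusterCount_union_parallel h₁ h₂ hS hst hφ₁ hφ₂
  have b₁ := clusterCount_insert_add_ite (γ₁ ∪ C₁) s t
  have bb₁ := clusterCount_insert_add_ite (N₁ \ γ₁ ∪ C₁) s t
  have b₂ := clusterCount_insert_add_ite (γ₂ ∪ C₂) s t
  have bb₂ := clusterCount_insert_add_ite (N₂ \ γ₂ ∪ C₂) s t
  set KS := clusterCount (↑(insert s(s, t) ((γ₁ ∪ A₁) ∪ (γ₂ ∪ A₂))) : BondConfig V) ∅
  set KSb := clusterCount (↑(insert s(s, t) ((N₁ \ γ₁ ∪ A₁) ∪ (N₂ \ γ₂ ∪ A₂))) : BondConfig V) ∅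
  set KC := clusterCount (↑((N₁ \ γ₁ ∪ C₁) ∪ (N₂ \ γ₂ ∪ C₂)) : BondConfig V) ∅
  set KG := clusterCount (↑((γ₁ ∪ C₁) ∪ (γ₂ ∪ C₂)) : BondConfig V) ∅
  set Y₁ := clusterCount (↑(insert s(s, t) (γ₁ ∪ A₁)) : BondConfig V) ∅
  set Yb₁ := clusterCount (↑(insert s(s, t) (N₁ \ γ₁ ∪ A₁)) : BondConfig V) ∅
  set Y₂ := clusterCount (↑(insert s(s, t) (γ₂ ∪ A₂)) : BondConfig V) ∅
  set Yb₂ := clusterCount (↑(insert s(s, t) (N₂ \ γ₂ ∪ A₂)) : BondConfig V) ∅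
  set G₁ := clusterCount (↑(γ₁ ∪ C₁) : BondConfig V) ∅
  set Gb₁ := clusterCount (↑(N₁ \ γ₁ ∪ C₁) : BondConfig V) ∅
  set G₂ := clusterCount (↑(γ₂ ∪ C₂) : BondConfig V) ∅
  set Gb₂ := clusterCount (↑(N₂ \ γ₂ ∪ C₂) : BondConfig V) ∅
  set B₁ := clusterCount (↑(insert s(s, t) (γ₁ ∪ C₁)) : BondConfig V) ∅
  set Bb₁ := clusterCount (↑(insert s(s, t) (N₁ \ γ₁ ∪ C₁)) : BondConfig V) ∅
  set B₂ := clusterCount (↑(insert s(s, t) (γ₂ ∪ C₂)) : BondConfig V) ∅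
  set Bb₂ := clusterCount (↑(insert s(s, t) (N₂ \ γ₂ ∪ C₂)) : BondConfig V) ∅
  -- the active terms telescope: (t1 or t3) + (t2 or t4)
  by_cases rb₂ : (openGraph (↑(N₂ \ γ₂ ∪ C₂) : BondConfig V)).Reachable s t <;>
  by_cases r₁ : (openGraph (↑(γ₁ ∪ C₁) : BondConfig V)).Reachable s t <;>
  by_cases rb₁ : (openGraph (↑(N₁ \ γ₁ ∪ C₁) : BondConfig V)).Reachable s t <;>
  by_cases r₂ : (openGraph (↑(γ₂ ∪ C₂) : BondConfig V)).Reachable s t <;>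
  simp only [r₁, rb₁, r₂, rb₂, and_self, and_true, true_and, and_false, false_and, if_true, if_false,
    not_false_eq_true, not_true_eq_false, add_zero, one_mul, zero_mul, zero_add] at b₁ bb₁ b₂ bb₂ eC eG ⊢
  -- rb₂, r₁ : t3 + t4
  · rw [show KS + KC + 2 * Fintype.card V = Y₁ + Bb₁ + (Y₂ + Gb₂ + 2) by omega,
      show Yb₁ + B₁ + (Y₂ + Gb₂ + 2) = Y₂ + Bb₂ + (Yb₁ + G₁ + 2) by omega,
      show KSb + KG + 2 * Fintype.card V = Yb₂ + B₂ + (Yb₁ + G₁ + 2) by omega]; ring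
  · rw [show KS + KC + 2 * Fintype.card V = Y₁ + Bb₁ + (Y₂ + Gb₂ + 2) by omega,
      show Yb₁ + B₁ + (Y₂ + Gb₂ + 2) = Y₂ + Bb₂ + (Yb₁ + G₁ + 2) by omega,
      show KSb + KG + 2 * Fintype.card V = Yb₂ + B₂ + (Yb₁ + G₁ + 2) by omega]; ring
  · rw [show KS + KC + 2 * Fintype.card V = Y₁ + Bb₁ + (Y₂ + Gb₂ + 2) by omega,
      show Yb₁ + B₁ + (Y₂ + Gb₂ + 2) = Y₂ + Bb₂ + (Yb₁ + G₁ + 2) by omega,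
      show KSb + KG + 2 * Fintype.card V = Yb₂ + B₂ + (Yb₁ + G₁ + 2) by omega]; ring
  · rw [show KS + KC + 2 * Fintype.card V = Y₁ + Bb₁ + (Y₂ + Gb₂ + 2) by omega,
      show Yb₁ + B₁ + (Y₂ + Gb₂ + 2) = Y₂ + Bb₂ + (Yb₁ + G₁ + 2) by omega,
      show KSb + KG + 2 * Fintype.card V = Yb₂ + B₂ + (Yb₁ + G₁ + 2) by omega]; ring
  -- rb₂, ¬r₁ : t3 + t2
  · rw [show KS + KC + 2 * Fintype.card V = Y₁ + Bb₁ + (Y₂ + Gb₂ + 2) by omega,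
      show Yb₁ + B₁ + (Y₂ + Gb₂ + 2) = Y₂ + Gb₂ + (Yb₁ + G₁ + 1) by omega,
      show KSb + KG + 2 * Fintype.card V = Yb₂ + G₂ + (Yb₁ + G₁ + 1) by omega]; ring
  · rw [show KS + KC + 2 * Fintype.card V = Y₁ + Bb₁ + (Y₂ + Gb₂ + 2) by omega,
      show Yb₁ + B₁ + (Y₂ + Gb₂ + 2) = Y₂ + Gb₂ + (Yb₁ + G₁ + 1) by omega,
      show KSb + KG + 2 * Fintype.card V = Yb₂ + G₂ + (Yb₁ + G₁ + 1) by omega]; ring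
  · rw [show KS + KC + 2 * Fintype.card V = Y₁ + Bb₁ + (Y₂ + Gb₂ + 2) by omega,
      show Yb₁ + B₁ + (Y₂ + Gb₂ + 2) = Y₂ + Gb₂ + (Yb₁ + G₁ + 1) by omega,
      show KSb + KG + 2 * Fintype.card V = Yb₂ + G₂ + (Yb₁ + G₁ + 1) by omega]; ring
  · rw [show KS + KC + 2 * Fintype.card V = Y₁ + Bb₁ + (Y₂ + Gb₂ + 2) by omega,
      show Yb₁ + B₁ + (Y₂ + Gb₂ + 2) = Y₂ + Gb₂ + (Yb₁ + G₁ + 1) by omega,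
      show KSb + KG + 2 * Fintype.card V = Yb₂ + G₂ + (Yb₁ + G₁ + 1) by omega]; ring
  -- ¬rb₂, r₁ : t1 + t4
  · rw [show KS + KC + 2 * Fintype.card V = Y₁ + Gb₁ + (Y₂ + Gb₂ + 1) by omega,
      show Yb₁ + G₁ + (Y₂ + Gb₂ + 1) = Y₂ + Bb₂ + (Yb₁ + G₁ + 2) by omega,
      show KSb + KG + 2 * Fintype.card V = Yb₂ + B₂ + (Yb₁ + G₁ + 2) by omega]; ring
  · rw [show KS + KC + 2 * Fintype.card V = Y₁ + Gb₁ + (Y₂ + Gb₂ + 1) by omega,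
      show Yb₁ + G₁ + (Y₂ + Gb₂ + 1) = Y₂ + Bb₂ + (Yb₁ + G₁ + 2) by omega,
      show KSb + KG + 2 * Fintype.card V = Yb₂ + B₂ + (Yb₁ + G₁ + 2) by omega]; ring
  · rw [show KS + KC + 2 * Fintype.card V = Y₁ + Gb₁ + (Y₂ + Gb₂ + 1) by omega,
      show Yb₁ + G₁ + (Y₂ + Gb₂ + 1) = Y₂ + Bb₂ + (Yb₁ + G₁ + 2) by omega,
      show KSb + KG + 2 * Fintype.card V = Yb₂ + B₂ + (Yb₁ + G₁ + 2) by omega]; ring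
  · rw [show KS + KC + 2 * Fintype.card V = Y₁ + Gb₁ + (Y₂ + Gb₂ + 1) by omega,
      show Yb₁ + G₁ + (Y₂ + Gb₂ + 1) = Y₂ + Bb₂ + (Yb₁ + G₁ + 2) by omega,
      show KSb + KG + 2 * Fintype.card V = Yb₂ + B₂ + (Yb₁ + G₁ + 2) by omega]; ring
  -- ¬rb₂, ¬r₁ : t1 + t2
  · rw [show KS + KC + 2 * Fintype.card V = Y₁ + Gb₁ + (Y₂ + Gb₂ + 1) by omega,
      show Yb₁ + G₁ + (Y₂ + Gb₂ + 1) = Y₂ + Gb₂ + (Yb₁ + G₁ + 1) by omega,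
      show KSb + KG + 2 * Fintype.card V = Yb₂ + G₂ + (Yb₁ + G₁ + 1) by omega]; ring
  · rw [show KS + KC + 2 * Fintype.card V = Y₁ + Gb₁ + (Y₂ + Gb₂ + 1) by omega,
      show Yb₁ + G₁ + (Y₂ + Gb₂ + 1) = Y₂ + Gb₂ + (Yb₁ + G₁ + 1) by omega,
      show KSb + KG + 2 * Fintype.card V = Yb₂ + G₂ + (Yb₁ + G₁ + 1) by omega]; ring
  · rw [show KS + KC + 2 * Fintype.card V = Y₁ + Gb₁ + (Y₂ + Gb₂ + 1) by omega,
      show Yb₁ + G₁ + (Y₂ + Gb₂ + 1) = Y₂ + Gb₂ + (Yb₁ + G₁ + 1) by omega,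
      show KSb + KG + 2 * Fintype.card V = Yb₂ + G₂ + (Yb₁ + G₁ + 1) by omega]; ring
  · rw [show KS + KC + 2 * Fintype.card V = Y₁ + Gb₁ + (Y₂ + Gb₂ + 1) by omega,
      show Yb₁ + G₁ + (Y₂ + Gb₂ + 1) = Y₂ + Gb₂ + (Yb₁ + G₁ + 1) by omega,
      show KSb + KG + 2 * Fintype.card V = Yb₂ + G₂ + (Yb₁ + G₁ + 1) by omega]; ring

/-- **THE GENERAL PARALLEL JUNCTION IDENTITY, WEIGHTED (summed).** [cite: Grimmett2006, §3.8 Thm. (3.90) (pp. 61–62)] -/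
theorem andGenW_parallel_eq (w : ℕ → ℝ) (h₁ : ∀ e ∈ (↑E₁ : Set (Sym2 V)), ∀ z ∈ e, z ∈ V₁)
    (h₂ : ∀ e ∈ (↑E₂ : Set (Sym2 V)), ∀ z ∈ e, z ∈ V₂) (hS : V₁ ∩ V₂ ⊆ {s, t}) (hst : s ≠ t)
    {N₁ A₁ C₁ N₂ A₂ C₂ : Finset (Sym2 V)} (hd : Disjoint N₁ N₂) (hN₁ : N₁ ⊆ E₁) (hA₁ : A₁ ⊆ E₁) (hC₁ : C₁ ⊆ E₁)
    (hN₂ : N₂ ⊆ E₂) (hA₂ : A₂ ⊆ E₂) (hC₂ : C₂ ⊆ E₂) (g : Finset (Sym2 V) → ℝ) :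
    ∑ γ ∈ (N₁ ∪ N₂).powerset,
        (w (clusterCount (↑(insert s(s, t) (γ ∪ (A₁ ∪ A₂))) : BondConfig V) ∅ +
              clusterCount (↑((N₁ ∪ N₂) \ γ ∪ (C₁ ∪ C₂)) : BondConfig V) ∅ + 2 * Fintype.card V) -
          w (clusterCount (↑(insert s(s, t) ((N₁ ∪ N₂) \ γ ∪ (A₁ ∪ A₂))) : BondConfig V) ∅ +
              clusterCount (↑(γ ∪ (C₁ ∪ C₂)) : BondConfig V) ∅ + 2 * Fintype.card V)) * g γ =
      ∑ γ₂ ∈ N₂.powerset,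
          ((if (openGraph (↑(N₂ \ γ₂ ∪ C₂) : BondConfig V)).Reachable s t then 0 else 1) *
              ∑ γ₁ ∈ N₁.powerset,
                (w (clusterCount (↑(insert s(s, t) (γ₁ ∪ A₁)) : BondConfig V) ∅ + clusterCount (↑(N₁ \ γ₁ ∪ C₁) : BondConfig V) ∅ +
                      (clusterCount (↑(insert s(s, t) (γ₂ ∪ A₂)) : BondConfig V) ∅ + clusterCount (↑(N₂ \ γ₂ ∪ C₂) : BondConfig V) ∅ + 1)) -
                  w (clusterCount (↑(insert s(s, t) (N₁ \ γ₁ ∪ A₁)) : BondConfig V) ∅ + clusterCount (↑(γ₁ ∪ C₁) : BondConfig V) ∅ +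
                      (clusterCount (↑(insert s(s, t) (γ₂ ∪ A₂)) : BondConfig V) ∅ + clusterCount (↑(N₂ \ γ₂ ∪ C₂) : BondConfig V) ∅ + 1))) *
                  g (γ₁ ∪ γ₂) +
            (if (openGraph (↑(N₂ \ γ₂ ∪ C₂) : BondConfig V)).Reachable s t then 1 else 0) *
              ∑ γ₁ ∈ N₁.powerset,
                (w (clusterCount (↑(insert s(s, t) (γ₁ ∪ A₁)) : BondConfig V) ∅ +
                      clusterCount (↑(insert s(s, t) (N₁ \ γ₁ ∪ C₁)) : BondConfig V) ∅ +
                      (clusterCount (↑(insert s(s, t) (γ₂ ∪ A₂)) : BondConfig V) ∅ + clusterCount (↑(N₂ \ γ₂ ∪ C₂) : BondConfig V) ∅ + 2)) -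
                  w (clusterCount (↑(insert s(s, t) (N₁ \ γ₁ ∪ A₁)) : BondConfig V) ∅ +
                      clusterCount (↑(insert s(s, t) (γ₁ ∪ C₁)) : BondConfig V) ∅ +
                      (clusterCount (↑(insert s(s, t) (γ₂ ∪ A₂)) : BondConfig V) ∅ + clusterCount (↑(N₂ \ γ₂ ∪ C₂) : BondConfig V) ∅ + 2))) *
                  g (γ₁ ∪ γ₂)) +
        ∑ γ₁ ∈ N₁.powerset,
          ((if (openGraph (↑(γ₁ ∪ C₁) : BondConfig V)).Reachable s t then 0 else 1) *
              ∑ γ₂ ∈ N₂.powerset,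
                (w (clusterCount (↑(insert s(s, t) (γ₂ ∪ A₂)) : BondConfig V) ∅ + clusterCount (↑(N₂ \ γ₂ ∪ C₂) : BondConfig V) ∅ +
                      (clusterCount (↑(insert s(s, t) (N₁ \ γ₁ ∪ A₁)) : BondConfig V) ∅ + clusterCount (↑(γ₁ ∪ C₁) : BondConfig V) ∅ + 1)) -
                  w (clusterCount (↑(insert s(s, t) (N₂ \ γ₂ ∪ A₂)) : BondConfig V) ∅ + clusterCount (↑(γ₂ ∪ C₂) : BondConfig V) ∅ +
                      (clusterCount (↑(insert s(s, t) (N₁ \ γ₁ ∪ A₁)) : BondConfig V) ∅ + clusterCount (↑(γ₁ ∪ C₁) : BondConfig V) ∅ + 1))) *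
                  g (γ₁ ∪ γ₂) +
            (if (openGraph (↑(γ₁ ∪ C₁) : BondConfig V)).Reachable s t then 1 else 0) *
              ∑ γ₂ ∈ N₂.powerset,
                (w (clusterCount (↑(insert s(s, t) (γ₂ ∪ A₂)) : BondConfig V) ∅ +
                      clusterCount (↑(insert s(s, t) (N₂ \ γ₂ ∪ C₂)) : BondConfig V) ∅ +
                      (clusterCount (↑(insert s(s, t) (N₁ \ γ₁ ∪ A₁)) : BondConfig V) ∅ + clusterCount (↑(γ₁ ∪ C₁) : BondConfig V) ∅ + 2)) -
                  w (clusterCount (↑(insert s(s, t) (N₂ \ γ₂ ∪ A₂)) : BondConfig V) ∅ +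
                      clusterCount (↑(insert s(s, t) (γ₂ ∪ C₂)) : BondConfig V) ∅ +
                      (clusterCount (↑(insert s(s, t) (N₁ \ γ₁ ∪ A₁)) : BondConfig V) ∅ + clusterCount (↑(γ₁ ∪ C₁) : BondConfig V) ∅ + 2))) *
                  g (γ₁ ∪ γ₂)) := by
  rw [sum_powerset_union_disj hd]
  simp_rw [Finset.mul_sum, ← Finset.sum_add_distrib]
  rw [Finset.sum_comm (s := N₂.powerset) (t := N₁.powerset), ← Finset.sum_add_distrib]
  refine Finset.sum_congr rfl fun γ₁ hγ₁ => ?_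
  rw [← Finset.sum_add_distrib]
  refine Finset.sum_congr rfl fun γ₂ hγ₂ => ?_
  rw [Finset.mem_powerset] at hγ₁ hγ₂
  rw [union_sdiff_union hd hγ₁ hγ₂, Finset.union_union_union_comm γ₁ γ₂ A₁ A₂,
    Finset.union_union_union_comm (N₁ \ γ₁) (N₂ \ γ₂) C₁ C₂, Finset.union_union_union_comm (N₁ \ γ₁) (N₂ \ γ₂) A₁ A₂,
    Finset.union_union_union_comm γ₁ γ₂ C₁ C₂,
    andGenW_summand_parallel w h₁ h₂ hS hst hN₁ hA₁ hC₁ hN₂ hA₂ hC₂ hγ₁ hγ₂ (g (γ₁ ∪ γ₂))]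
  ring

/-- **The weighted general AND-drift across a parallel junction (abstract form, ANTITONE weights).**  If on each side the weighted general
AND-drift with root `st` (attached `Aᵢ`, contracted `Cᵢ`) and the weighted `st`-CONTRACTED drift (attached `Aᵢ ∪ st`, contracted `Cᵢ ∪ st`) are
`≤ 0` for every antitone weight and every monotone test function, then so is the weighted drift of the composite (attached `A₁ ∪ A₂`, contracted
`C₁ ∪ C₂`, root `st`). [cite: Grimmett2006, §3.8 Thm. (3.90) (pp. 61–62)] -/
theorem andGenW_parallel_nonpos (h₁ : ∀ e ∈ (↑E₁ : Set (Sym2 V)), ∀ z ∈ e, z ∈ V₁)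
    (h₂ : ∀ e ∈ (↑E₂ : Set (Sym2 V)), ∀ z ∈ e, z ∈ V₂) (hS : V₁ ∩ V₂ ⊆ {s, t}) (hst : s ≠ t)
    {N₁ A₁ C₁ N₂ A₂ C₂ : Finset (Sym2 V)} (hd : Disjoint N₁ N₂) (hN₁ : N₁ ⊆ E₁) (hA₁ : A₁ ⊆ E₁) (hC₁ : C₁ ⊆ E₁)
    (hN₂ : N₂ ⊆ E₂) (hA₂ : A₂ ⊆ E₂) (hC₂ : C₂ ⊆ E₂)
    (hY₁ : ∀ w' : ℕ → ℝ, (∀ n : ℕ, w' (n + 1) ≤ w' n) → ∀ h' : Finset (Sym2 V) → ℝ,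
      (∀ ⦃A B : Finset (Sym2 V)⦄, A ⊆ B → B ⊆ N₁ → h' A ≤ h' B) →
      ∑ γ₁ ∈ N₁.powerset, (w' (clusterCount (↑(insert s(s, t) (γ₁ ∪ A₁)) : BondConfig V) ∅ + clusterCount (↑(N₁ \ γ₁ ∪ C₁) : BondConfig V) ∅) -
        w' (clusterCount (↑(insert s(s, t) (N₁ \ γ₁ ∪ A₁)) : BondConfig V) ∅ + clusterCount (↑(γ₁ ∪ C₁) : BondConfig V) ∅)) * h' γ₁ ≤ 0)
    (hX₁ : ∀ w' : ℕ → ℝ, (∀ n : ℕ, w' (n + 1) ≤ w' n) → ∀ h' : Finset (Sym2 V) → ℝ,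
      (∀ ⦃A B : Finset (Sym2 V)⦄, A ⊆ B → B ⊆ N₁ → h' A ≤ h' B) →
      ∑ γ₁ ∈ N₁.powerset, (w' (clusterCount (↑(insert s(s, t) (γ₁ ∪ A₁)) : BondConfig V) ∅ +
          clusterCount (↑(insert s(s, t) (N₁ \ γ₁ ∪ C₁)) : BondConfig V) ∅) -
        w' (clusterCount (↑(insert s(s, t) (N₁ \ γ₁ ∪ A₁)) : BondConfig V) ∅ +
          clusterCount (↑(insert s(s, t) (γ₁ ∪ C₁)) : BondConfig V) ∅)) * h' γ₁ ≤ 0)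
    (hY₂ : ∀ w' : ℕ → ℝ, (∀ n : ℕ, w' (n + 1) ≤ w' n) → ∀ h' : Finset (Sym2 V) → ℝ,
      (∀ ⦃A B : Finset (Sym2 V)⦄, A ⊆ B → B ⊆ N₂ → h' A ≤ h' B) →
      ∑ γ₂ ∈ N₂.powerset, (w' (clusterCount (↑(insert s(s, t) (γ₂ ∪ A₂)) : BondConfig V) ∅ + clusterCount (↑(N₂ \ γ₂ ∪ C₂) : BondConfig V) ∅) -
        w' (clusterCount (↑(insert s(s, t) (N₂ \ γ₂ ∪ A₂)) : BondConfig V) ∅ + clusterCount (↑(γ₂ ∪ C₂) : BondConfig V) ∅)) * h' γ₂ ≤ 0)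
    (hX₂ : ∀ w' : ℕ → ℝ, (∀ n : ℕ, w' (n + 1) ≤ w' n) → ∀ h' : Finset (Sym2 V) → ℝ,
      (∀ ⦃A B : Finset (Sym2 V)⦄, A ⊆ B → B ⊆ N₂ → h' A ≤ h' B) →
      ∑ γ₂ ∈ N₂.powerset, (w' (clusterCount (↑(insert s(s, t) (γ₂ ∪ A₂)) : BondConfig V) ∅ +
          clusterCount (↑(insert s(s, t) (N₂ \ γ₂ ∪ C₂)) : BondConfig V) ∅) -
        w' (clusterCount (↑(insert s(s, t) (N₂ \ γ₂ ∪ A₂)) : BondConfig V) ∅ +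
          clusterCount (↑(insert s(s, t) (γ₂ ∪ C₂)) : BondConfig V) ∅)) * h' γ₂ ≤ 0)
    {w : ℕ → ℝ} (hw : ∀ n : ℕ, w (n + 1) ≤ w n)
    {g : Finset (Sym2 V) → ℝ} (hmono : ∀ ⦃A B : Finset (Sym2 V)⦄, A ⊆ B → B ⊆ N₁ ∪ N₂ → g A ≤ g B) :
    ∑ γ ∈ (N₁ ∪ N₂).powerset,
        (w (clusterCount (↑(insert s(s, t) (γ ∪ (A₁ ∪ A₂))) : BondConfig V) ∅ +
              clusterCount (↑((N₁ ∪ N₂) \ γ ∪ (C₁ ∪ C₂)) : BondConfig V) ∅) -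
          w (clusterCount (↑(insert s(s, t) ((N₁ ∪ N₂) \ γ ∪ (A₁ ∪ A₂))) : BondConfig V) ∅ +
              clusterCount (↑(γ ∪ (C₁ ∪ C₂)) : BondConfig V) ∅)) * g γ ≤ 0 := by
  have key := andGenW_parallel_eq (fun k => w (k - 2 * Fintype.card V)) h₁ h₂ hS hst hd hN₁ hA₁ hC₁ hN₂ hA₂ hC₂ g
  simp only [Nat.add_sub_cancel] at key
  rw [key]
  have sec₁ : ∀ γ₂ ∈ N₂.powerset, ∀ ⦃A B : Finset (Sym2 V)⦄, A ⊆ B → B ⊆ N₁ → g (A ∪ γ₂) ≤ g (B ∪ γ₂) := by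
    intro γ₂ hγ₂ A B hAB hB
    rw [Finset.mem_powerset] at hγ₂
    exact hmono (Finset.union_subset_union hAB le_rfl) (Finset.union_subset_union hB hγ₂)
  have sec₂ : ∀ γ₁ ∈ N₁.powerset, ∀ ⦃A B : Finset (Sym2 V)⦄, A ⊆ B → B ⊆ N₂ → g (γ₁ ∪ A) ≤ g (γ₁ ∪ B) := by
    intro γ₁ hγ₁ A B hAB hB
    rw [Finset.mem_powerset] at hγ₁
    exact hmono (Finset.union_subset_union le_rfl hAB) (Finset.union_subset_union hγ₁ hB)
  have shift : ∀ c : ℕ, ∀ n : ℕ, w (n + 1 + c - 2 * Fintype.card V) ≤ w (n + c - 2 * Fintype.card V) := fun c n => by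
    have := antitoneW_sub hw (2 * Fintype.card V) (n + c)
    rw [Nat.add_right_comm n 1 c]
    exact this
  refine add_nonpos (Finset.sum_nonpos fun γ₂ hγ₂ => ?_) (Finset.sum_nonpos fun γ₁ hγ₁ => ?_)
  · set c₂ := clusterCount (↑(insert s(s, t) (γ₂ ∪ A₂)) : BondConfig V) ∅ + clusterCount (↑(N₂ \ γ₂ ∪ C₂) : BondConfig V) ∅ with hc₂
    have i₁ := hY₁ (fun n => w (n + (c₂ + 1) - 2 * Fintype.card V)) (shift (c₂ + 1)) (fun γ₁ => g (γ₁ ∪ γ₂)) (sec₁ γ₂ hγ₂)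
    have i₂ := hX₁ (fun n => w (n + (c₂ + 2) - 2 * Fintype.card V)) (shift (c₂ + 2)) (fun γ₁ => g (γ₁ ∪ γ₂)) (sec₁ γ₂ hγ₂)
    refine add_nonpos (mul_nonpos_of_nonneg_of_nonpos ?_ i₁) (mul_nonpos_of_nonneg_of_nonpos ?_ i₂) <;>
    split_ifs <;> norm_num
  · set c₁ := clusterCount (↑(insert s(s, t) (N₁ \ γ₁ ∪ A₁)) : BondConfig V) ∅ + clusterCount (↑(γ₁ ∪ C₁) : BondConfig V) ∅ with hc₁
    have i₁ := hY₂ (fun n => w (n + (c₁ + 1) - 2 * Fintype.card V)) (shift (c₁ + 1)) (fun γ₂ => g (γ₁ ∪ γ₂)) (sec₂ γ₁ hγ₁)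
    have i₂ := hX₂ (fun n => w (n + (c₁ + 2) - 2 * Fintype.card V)) (shift (c₁ + 2)) (fun γ₂ => g (γ₁ ∪ γ₂)) (sec₂ γ₁ hγ₁)
    refine add_nonpos (mul_nonpos_of_nonneg_of_nonpos ?_ i₁) (mul_nonpos_of_nonneg_of_nonpos ?_ i₂) <;>
    split_ifs <;> norm_num

end GenParallelW

end FK

end Summit.CriticalPhenomena.PercolationContinuityZ3.Theorems

end
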